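import Literature.MathematicalPhysics.QuantumFieldTheory.BalabanImbrieJaffe1984to88.BIJ88SlotMoments308

/-!
# `BalabanImbrieJaffe1984to88.BIJ88OneCubeSlotEstimates309` — T. Bałaban, J. Imbrie, A. Jaffe, *Effective action and cluster properties of the
abelian Higgs model*, Commun. Math. Phys. **114** (1988) 257–315 [BalabanImbrieJaffe1988], Sect. 5.14 p. 309 [PDF 53] (the proof of (5.14.4)) with
Sect. 5.13 p. 307 [PDF 51]: **THE ONE-CUBE INTEGRAND OF (5.14.3) — EVERY SLOT DIFFERENTIATED ON ITS OWN — BOUNDED POINTWISE AND INTEGRATED OVER A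
PROBABILITY SPACE** (file 1 of 3 of the one-cube part `|X_β| = 1` of the leaf (5.14.4); siblings `BIJ88OneCubeVertexFactors309` (the `e_k`-small
regime: the bounds as powers of the vertex factor) and `BIJ88Ineq5144OneCube` (the §5.13 model: (5.14.4) on one-cube polymers, located reading)).

statement-level skeleton of published theorems with citation tags; proofs where landed; nothing here is a claim about the Yang–Mills mass gap

p. 309, verbatim: *"Each factor V^{(k)}(Y) in Π (d/dt)_{γ_j} produces a factor e^β(L^kε/ε₀)^{1/4−α} in the final estimate. … Each t-derivative of a
χ-factor in χ′_{Λ₁₂^{(k)},t} gives at least a factor e^β(L^kε/ε₀)^{1/4−α}. This follows because … the n-th derivative in t of χ(cp(e_k), A^{(k)})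
[sic; = χ(cp(te_k), A^{(k)})] is bounded by t^{−n} times a function bounded by a constant and supported in c₁p(te_k) ≤ |A^{(k)}| ≤ c₂p(te_k).
After integration over A^{(k)}, we obtain factors ct^{−n}e^{−cp(te_k)²} ≤ (e^β(L^kε/ε₀)^{1/4−α})ⁿ. Similar bounds hold for φ^{(k)}. The bound for
H_β = ∅, |X_β| = 1 was obtained for g₂, and the same proof applies here."*  p. 307, verbatim: *"If |X_α| = 1, with no F^{m̄}_{k,loc}-factors, then
we have the more precise bound |g₂(X_α) − 1| ≤ e^β(L^kε/ε₀)^{1/4−α}, obtained from the same estimates on the S_Y, S₅ sums, and from extremely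
small factors when a χ′-factor is replaced by 1."*  PDF held: `paper:balaban1988-cmp114-bij-abelian-higgs-effective-action` (journal page =
PDF page + 256); pp. 307–309 = PDF 51–53 read this generation (`p0051.txt`, `p0053.txt`).

WHAT IS REPRODUCED (unit `lit-balaban-p36`, generation 15 of the Phase-2 proof seat p36; SKELETON row **C2.Eq5.14.3-5.14.4** member cell of
`HOME/lit-balaban-r16/ROWS-C2-part2.md`, owner r16, head untouched; HOME `run/shared/lean/pub/lit-balaban/`).  The p. 308 integrand of ONE cube is
the product over its slots `τ` — χ-slots `inl b` carrying `s ↦ χ(c_b p(se_k), Φ_b)`, interaction slots `inr Y` carrying `s ↦ e^{−sV(Y)}`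
(`BIJ88SlotMoments308.slotFactor`, p. 308: *"(d/dt)_γ acts only on the t before a particular term V^{(k)}(Y) in Ṽ^{(k)} or in a particular
χ-factor"*) — slot `τ` differentiated `m_τ` times; the slot set `T` of the cube, the slot fields `Φ_b` and terms `V(Y)` live on ANY probability space.
Theorems only (0 definitions, 0 `Prop` facts):
* §0 `pLog_pos` (`p(x) > 0` for `0 < x < 1`).
* §1 POINTWISE: `abs_iteratedDeriv_slotFactor_inl_le` (one χ-slot: `Ĉ^m t^{−m}·𝟙{(9/10)|c_b|p(te_k) ≤ |Φ_b|}`, `Ĉ` the all-orders constant of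
  `BIJ88GaussIntegration309Product.exists_const_all_orders`, support by `BIJ88ChiTDerivN309.support_iteratedDeriv_cutoff_t`),
  `abs_iteratedDeriv_slotFactor_inr_le` (one term: `K^m e^K`), `abs_prod_slotFactor_le` (undifferentiated cube: `e^{Σ K_Y}`),
  **`abs_prod_iteratedDeriv_slotFactor_le`** (`Ĉ^{n_χ} t^{−n_χ} (Π_Y K_Y^{m_Y}) e^{Σ K_Y} Π_{b : m_b ≥ 1} 𝟙{tail_b}`);
  INTEGRATED: **`integral_abs_prod_iteratedDeriv_slotFactor_le`** (a differentiated χ-slot `b₀`: ONE tail probability `P{(9/10)|c_{b₀}|p(te_k) ≤ |Φ_{b₀}|}`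
  per cube), `integral_abs_prod_iteratedDeriv_slotFactor_le_of_inr` (only terms differentiated), `measurable_prod_slotFactor`,
  **`abs_integral_prod_slotFactor_sub_one_le`** (no derivative, `χ ≥ 0`: `|∫ χ′_{□,t} e^{−tṼ(□)} dP − 1| ≤ e^{ΣK} Σ_b P{tail_b} + (e^{ΣK} − 1)` — a
  χ-factor replaced by `1` costs its tail, `e^{−tṼ}` replaced by `1` costs `e^{ΣK} − 1`).
HONEST SCOPE: in the paper `V^{(k)}(Y)` is a small POLYNOMIAL of the fields and its smallness *"is obtained in the Gaussian integration estimate"*; in the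
§5.13 model of this lineage (gens 8–14) the terms are bounded measurable, `|V(Y)| ≤ K_Y`, and the bounds are stated in that currency.  Nothing here
is the inductive multi-cube decay of (5.14.4).  0 `sorry`, 0 definitions, 0 `Prop` facts (D-0026); imports `BIJ88SlotMoments308` (p36 g10) only;
modifies nothing.  NOT summit progress; NOT continuum; NOT Clay.  Cell `lit-balaban` Phase 2, seat p36 gen 15 (owner r16, referee ref-5).
-/

noncomputable section

open Finset MeasureTheory
open Literature.MathematicalPhysics.QuantumFieldTheory.BalabanImbrieJaffe1984to88
open BIJ88Sect2Statements (pLog)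
open BIJ88Sect5Statements (CutoffProfile cutoff)
open BIJ88SlotMoments308 (slotFactor slotFactor_inl slotFactor_inr)
open BIJ88RestrictedInteractionAllOrders308 (iteratedDeriv_expWeight)
open BIJ88GaussIntegration309Product (abs_cutoff_le_one)
open BIJ88ChiTDerivN309 (support_iteratedDeriv_cutoff_t)

namespace Literature.MathematicalPhysics.QuantumFieldTheory.BalabanImbrieJaffe1984to88.BIJ88OneCubeSlotEstimates309

/-! ## §0 A scalar fact -/

/-- for `0 < x ≤ e_k ≤ e⁻¹ `: `p(x) = |log x⁻¹|^p > 0`. [cite: BalabanImbrieJaffe1988, (2.33) p.263] -/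
theorem pLog_pos (p : ℝ) {x : ℝ} (hx0 : 0 < x) (hx1 : x < 1) : 0 < pLog p x := by
  unfold pLog
  have : 0 < Real.log x⁻¹ := Real.log_pos ((one_lt_inv₀ hx0).mpr hx1)
  exact Real.rpow_pos_of_pos (abs_pos.mpr this.ne') p

/-! ## §1 One cube's slot factors on a probability space: pointwise bounds and the three integral estimates

The p. 308 integrand of ONE cube is the product over its slots `τ` — χ-slots `inl b` carrying `s ↦ χ(c_b p(se_k), Φ_b)`, interaction slots
`inr Y` carrying `s ↦ e^{−sV(Y)}` (`BIJ88SlotMoments308.slotFactor`) — each differentiated `m_τ` times in `t` (p. 308: *"(d/dt)_γ acts only on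
the t before a particular term V^{(k)}(Y) in Ṽ^{(k)} or in a particular χ-factor"*).  The slot set of the cube is an arbitrary finite set `T` of slots. -/

section Pointwise

variable (χ : CutoffProfile) {ι υ Ω : Type*}
variable (p ek : ℝ) (B : Finset ι) (Φ : ι → Ω → ℝ) (c : ι → ℝ) (Ys : Finset υ) (V : υ → Ω → ℝ)

/-- **p. 309, one χ-slot** (*"the n-th derivative in t of χ(cp(e_k), A^{(k)}) [sic; = χ(cp(te_k), A^{(k)})] is bounded by t^{−n}
times a function bounded by a constant and supported in c₁p(te_k) ≤ |A^{(k)}| ≤ c₂p(te_k)"*): with the all-orders constant `Ĉ ≥ 1` of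
`BIJ88GaussIntegration309Product.exists_const_all_orders` (orders `≤ n₀`), the `m`-th `t`-derivative of the χ-slot `b` is bounded by `Ĉ^m t^{−m}`
times — when `m ≥ 1` — the indicator of the tail `(9/10)|c_b| p(te_k) ≤ |Φ_b|`; for `m = 0` by `1`. [cite: BalabanImbrieJaffe1988, (5.14.4) p.309] -/
theorem abs_iteratedDeriv_slotFactor_inl_le {C : ℝ} (hC1 : 1 ≤ C) {n₀ : ℕ}
    (hC : ∀ i, i ≤ n₀ → ∀ (A : ℝ) ⦃q ek t : ℝ⦄, q ≠ 0 → 0 < ek → 0 < t → t * ek ≤ Real.exp (-1) →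
      |iteratedDeriv i (fun s => cutoff χ (q * pLog p (s * ek)) A) t| ≤ C * t ^ (-(i : ℤ)))
    {t : ℝ} (hek : 0 < ek) (ht : 0 < t) (h1 : t * ek ≤ Real.exp (-1)) (ω : Ω) {b : ↥B} (hcb : c b ≠ 0)
    {m : ℕ} (hm : m ≤ n₀) :
    |iteratedDeriv m (slotFactor χ p ek B Φ c Ys V ω (Sum.inl b)) t| ≤
      C ^ m * t⁻¹ ^ m *
        (if 1 ≤ m then Set.indicator {x : ℝ | 9 / 10 * (|c b| * pLog p (t * ek)) ≤ |x|} (fun _ => (1 : ℝ)) (Φ b ω) else 1) := by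
  rw [slotFactor_inl]
  rcases Nat.eq_zero_or_pos m with rfl | hm1
  · simp only [iteratedDeriv_zero, pow_zero, if_false, mul_one, Nat.one_le_iff_ne_zero, ne_eq, not_true_eq_false]
    exact abs_cutoff_le_one χ _ _
  · have h1' : t * ek < 1 := h1.trans_lt (by rw [← Real.exp_zero]; exact Real.exp_lt_exp.mpr (by norm_num))
    have hm1' : 1 ≤ m := hm1
    rw [if_pos hm1']
    by_cases hx : 9 / 10 * (|c b| * pLog p (t * ek)) ≤ |Φ b ω|
    · rw [Set.indicator_of_mem (show Φ b ω ∈ {x : ℝ | 9 / 10 * (|c b| * pLog p (t * ek)) ≤ |x|} from hx), mul_one]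
      have hzpow : t ^ (-(m : ℤ)) = t⁻¹ ^ m := by rw [zpow_neg, zpow_natCast, inv_pow]
      calc |iteratedDeriv m (fun s => cutoff χ (c b * pLog p (s * ek)) (Φ b ω)) t| ≤ C * t ^ (-(m : ℤ)) :=
            hC m hm (Φ b ω) hcb hek ht h1
        _ ≤ C ^ m * t⁻¹ ^ m := by
            rw [hzpow]
            exact mul_le_mul_of_nonneg_right (le_self_pow₀ hC1 (by omega)) (pow_nonneg (inv_nonneg.mpr ht.le) _)
    · have h0 : iteratedDeriv m (fun s => cutoff χ (c b * pLog p (s * ek)) (Φ b ω)) t = 0 := by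
        by_contra hne
        exact hx (support_iteratedDeriv_cutoff_t χ p hm1' hcb hek ht h1' hne).1
      rw [h0, abs_zero, Set.indicator_of_notMem (show Φ b ω ∉ {x : ℝ | 9 / 10 * (|c b| * pLog p (t * ek)) ≤ |x|} from hx),
        mul_zero]

/-- **p. 309, one interaction slot** (*"Each factor V^{(k)}(Y) in Π (d/dt)_{γ_j} produces a factor …"*): `(d/dt)^m e^{−tV(Y)} = (−V(Y))^m e^{−tV(Y)}`,
bounded by `K^m e^K` when `|V(Y)| ≤ K`, `0 ≤ t ≤ 1`. [cite: BalabanImbrieJaffe1988, (5.14.4) p.309] -/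
theorem abs_iteratedDeriv_slotFactor_inr_le {t : ℝ} (ht0 : 0 ≤ t) (ht1 : t ≤ 1) (ω : Ω) (Y : ↥Ys) {K : ℝ} (hK : |V Y ω| ≤ K)
    (m : ℕ) : |iteratedDeriv m (slotFactor χ p ek B Φ c Ys V ω (Sum.inr Y)) t| ≤ K ^ m * Real.exp K := by
  rw [slotFactor_inr, iteratedDeriv_expWeight, abs_mul, abs_pow, abs_neg, Real.abs_exp]
  refine mul_le_mul (pow_le_pow_left₀ (abs_nonneg _) hK m) (Real.exp_le_exp.mpr ?_) (Real.exp_pos _).le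
    (pow_nonneg ((abs_nonneg _).trans hK) m)
  have h := neg_le_abs (t * V Y ω)
  rw [abs_mul, abs_of_nonneg ht0] at h
  nlinarith [abs_nonneg (V Y ω)]

/-- the undifferentiated one-cube integrand `χ′_{□,t} e^{−tṼ(□)}` is bounded by `e^{Σ_Y K_Y}` (`|χ| ≤ 1`, `|V(Y)| ≤ K_Y`, `0 ≤ t ≤ 1`).
[cite: BalabanImbrieJaffe1988, (5.14.2) p.308] -/
theorem abs_prod_slotFactor_le {t : ℝ} (ht0 : 0 ≤ t) (ht1 : t ≤ 1) (ω : Ω) (T : Finset (↥B ⊕ ↥Ys)) (KY : υ → ℝ)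
    (hK : ∀ Y ∈ T.toRight, |V Y ω| ≤ KY Y) :
    |∏ τ ∈ T, slotFactor χ p ek B Φ c Ys V ω τ t| ≤ Real.exp (∑ Y ∈ T.toRight, KY Y) := by
  rw [Finset.abs_prod, Finset.prod_sum_eq_prod_toLeft_mul_prod_toRight, Real.exp_sum]
  have hL : ∏ b ∈ T.toLeft, |slotFactor χ p ek B Φ c Ys V ω (Sum.inl b) t| ≤ 1 :=
    prod_le_one (fun _ _ => abs_nonneg _) fun b _ => by rw [slotFactor_inl]; exact abs_cutoff_le_one χ _ _
  have hR : ∏ Y ∈ T.toRight, |slotFactor χ p ek B Φ c Ys V ω (Sum.inr Y) t| ≤ ∏ Y ∈ T.toRight, Real.exp (KY Y) :=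
    prod_le_prod (fun _ _ => abs_nonneg _) fun Y hY => by
      simpa using abs_iteratedDeriv_slotFactor_inr_le χ p ek B Φ c Ys V ht0 ht1 ω Y (hK Y hY) 0
  calc (∏ b ∈ T.toLeft, |slotFactor χ p ek B Φ c Ys V ω (Sum.inl b) t|) *
        ∏ Y ∈ T.toRight, |slotFactor χ p ek B Φ c Ys V ω (Sum.inr Y) t|
      ≤ 1 * ∏ Y ∈ T.toRight, Real.exp (KY Y) :=
        mul_le_mul hL hR (prod_nonneg fun _ _ => abs_nonneg _) zero_le_one
    _ = ∏ Y ∈ T.toRight, Real.exp (KY Y) := one_mul _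

/-- **p. 309, the differentiated one-cube integrand, pointwise**: `|Π_τ (d/dt)^{m_τ} slotFactor_τ| ≤ Ĉ^{n_χ} t^{−n_χ} (Π_Y K_Y^{m_Y}) e^{Σ_Y K_Y} ·
Π_{b : m_b ≥ 1} 𝟙{(9/10)|c_b|p(te_k) ≤ |Φ_b|}`, `n_χ = Σ_b m_b` the number of derivatives on χ-slots. [cite: BalabanImbrieJaffe1988, (5.14.4) p.309] -/
theorem abs_prod_iteratedDeriv_slotFactor_le {C : ℝ} (hC1 : 1 ≤ C) {n₀ : ℕ}
    (hC : ∀ i, i ≤ n₀ → ∀ (A : ℝ) ⦃q ek t : ℝ⦄, q ≠ 0 → 0 < ek → 0 < t → t * ek ≤ Real.exp (-1) →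
      |iteratedDeriv i (fun s => cutoff χ (q * pLog p (s * ek)) A) t| ≤ C * t ^ (-(i : ℤ)))
    {t : ℝ} (hek : 0 < ek) (ht : 0 < t) (ht1 : t ≤ 1) (h1 : t * ek ≤ Real.exp (-1)) (ω : Ω)
    (T : Finset (↥B ⊕ ↥Ys)) (m : ↥B ⊕ ↥Ys → ℕ) (hm : ∀ b ∈ T.toLeft, m (Sum.inl b) ≤ n₀)
    (hcb : ∀ b ∈ T.toLeft, c b ≠ 0) (KY : υ → ℝ) (hK : ∀ Y ∈ T.toRight, |V Y ω| ≤ KY Y) :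
    |∏ τ ∈ T, iteratedDeriv (m τ) (slotFactor χ p ek B Φ c Ys V ω τ) t| ≤
      C ^ (∑ b ∈ T.toLeft, m (Sum.inl b)) * t⁻¹ ^ (∑ b ∈ T.toLeft, m (Sum.inl b)) *
        ((∏ Y ∈ T.toRight, KY Y ^ m (Sum.inr Y)) * Real.exp (∑ Y ∈ T.toRight, KY Y)) *
        ∏ b ∈ T.toLeft, (if 1 ≤ m (Sum.inl b) then
          Set.indicator {x : ℝ | 9 / 10 * (|c b| * pLog p (t * ek)) ≤ |x|} (fun _ => (1 : ℝ)) (Φ b ω) else 1) := by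
  rw [Finset.abs_prod, Finset.prod_sum_eq_prod_toLeft_mul_prod_toRight]
  have hL : ∏ b ∈ T.toLeft, |iteratedDeriv (m (Sum.inl b)) (slotFactor χ p ek B Φ c Ys V ω (Sum.inl b)) t| ≤
      ∏ b ∈ T.toLeft, (C ^ m (Sum.inl b) * t⁻¹ ^ m (Sum.inl b) *
        (if 1 ≤ m (Sum.inl b) then
          Set.indicator {x : ℝ | 9 / 10 * (|c b| * pLog p (t * ek)) ≤ |x|} (fun _ => (1 : ℝ)) (Φ b ω) else 1)) :=
    prod_le_prod (fun _ _ => abs_nonneg _) fun b hb =>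
      abs_iteratedDeriv_slotFactor_inl_le χ p ek B Φ c Ys V hC1 hC hek ht h1 ω (hcb b hb) (hm b hb)
  have hR : ∏ Y ∈ T.toRight, |iteratedDeriv (m (Sum.inr Y)) (slotFactor χ p ek B Φ c Ys V ω (Sum.inr Y)) t| ≤
      ∏ Y ∈ T.toRight, (KY Y ^ m (Sum.inr Y) * Real.exp (KY Y)) :=
    prod_le_prod (fun _ _ => abs_nonneg _) fun Y hY =>
      abs_iteratedDeriv_slotFactor_inr_le χ p ek B Φ c Ys V ht.le ht1 ω Y (hK Y hY) _
  rw [prod_mul_distrib, prod_mul_distrib, prod_pow_eq_pow_sum, prod_pow_eq_pow_sum] at hL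
  rw [prod_mul_distrib, ← Real.exp_sum] at hR
  have hJ : 0 ≤ ∏ b ∈ T.toLeft, (if 1 ≤ m (Sum.inl b) then
      Set.indicator {x : ℝ | 9 / 10 * (|c b| * pLog p (t * ek)) ≤ |x|} (fun _ => (1 : ℝ)) (Φ b ω) else 1) :=
    prod_nonneg fun b _ => by
      split_ifs
      · exact Set.indicator_nonneg (fun _ _ => zero_le_one) _
      · exact zero_le_one
  calc (∏ b ∈ T.toLeft, |iteratedDeriv (m (Sum.inl b)) (slotFactor χ p ek B Φ c Ys V ω (Sum.inl b)) t|) *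
        ∏ Y ∈ T.toRight, |iteratedDeriv (m (Sum.inr Y)) (slotFactor χ p ek B Φ c Ys V ω (Sum.inr Y)) t|
      ≤ (C ^ (∑ b ∈ T.toLeft, m (Sum.inl b)) * t⁻¹ ^ (∑ b ∈ T.toLeft, m (Sum.inl b)) *
          ∏ b ∈ T.toLeft, (if 1 ≤ m (Sum.inl b) then
            Set.indicator {x : ℝ | 9 / 10 * (|c b| * pLog p (t * ek)) ≤ |x|} (fun _ => (1 : ℝ)) (Φ b ω) else 1)) *
          ((∏ Y ∈ T.toRight, KY Y ^ m (Sum.inr Y)) * Real.exp (∑ Y ∈ T.toRight, KY Y)) :=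
        mul_le_mul hL hR (prod_nonneg fun _ _ => abs_nonneg _)
          (mul_nonneg (mul_nonneg (pow_nonneg (by linarith) _) (pow_nonneg (inv_nonneg.mpr ht.le) _)) hJ)
    _ = _ := by ring

end Pointwise

/-! ### The three integral estimates (any probability space; the tail of the slot fields is the input) -/

section Integral

variable (χ : CutoffProfile) {ι υ Ω : Type*} [MeasurableSpace Ω] (P : Measure Ω)
variable (p ek : ℝ) (B : Finset ι) (Φ : ι → Ω → ℝ) (c : ι → ℝ) (Ys : Finset υ) (V : υ → Ω → ℝ)

/-- **p. 309, AT LEAST ONE `t`-DERIVATIVE ON A χ-SLOT** (*"After integration over A^{(k)} we obtain factors ct^{−n}e^{−cp(te_k)²}"*): if the χ-slot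
`b₀` of the cube is differentiated, `∫ |Π_τ (d/dt)^{m_τ} slotFactor_τ| dP ≤ Ĉ^{n_χ} t^{−n_χ} (Π_Y K_Y^{m_Y}) e^{Σ_Y K_Y} · P{(9/10)|c_{b₀}|p(te_k) ≤ |Φ_{b₀}|}`
— ONE tail probability per cube (finite measure `P`, measurable `Φ_b`). [cite: BalabanImbrieJaffe1988, (5.14.4) p.309] -/
theorem integral_abs_prod_iteratedDeriv_slotFactor_le [IsFiniteMeasure P] {C : ℝ} (hC1 : 1 ≤ C) {n₀ : ℕ}
    (hC : ∀ i, i ≤ n₀ → ∀ (A : ℝ) ⦃q ek t : ℝ⦄, q ≠ 0 → 0 < ek → 0 < t → t * ek ≤ Real.exp (-1) →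
      |iteratedDeriv i (fun s => cutoff χ (q * pLog p (s * ek)) A) t| ≤ C * t ^ (-(i : ℤ)))
    {t : ℝ} (hek : 0 < ek) (ht : 0 < t) (ht1 : t ≤ 1) (h1 : t * ek ≤ Real.exp (-1))
    (T : Finset (↥B ⊕ ↥Ys)) (m : ↥B ⊕ ↥Ys → ℕ) (hm : ∀ b ∈ T.toLeft, m (Sum.inl b) ≤ n₀)
    (hcb : ∀ b ∈ T.toLeft, c b ≠ 0) (KY : υ → ℝ) (hK : ∀ Y ∈ T.toRight, ∀ ω, |V Y ω| ≤ KY Y) (hKY0 : ∀ Y ∈ T.toRight, 0 ≤ KY Y)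
    (hΦ : ∀ b ∈ T.toLeft, Measurable (Φ b)) {b₀ : ↥B} (hb₀ : b₀ ∈ T.toLeft) (hmb₀ : 1 ≤ m (Sum.inl b₀)) :
    ∫ ω, |∏ τ ∈ T, iteratedDeriv (m τ) (slotFactor χ p ek B Φ c Ys V ω τ) t| ∂P ≤
      C ^ (∑ b ∈ T.toLeft, m (Sum.inl b)) * t⁻¹ ^ (∑ b ∈ T.toLeft, m (Sum.inl b)) *
        ((∏ Y ∈ T.toRight, KY Y ^ m (Sum.inr Y)) * Real.exp (∑ Y ∈ T.toRight, KY Y)) *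
        P.real {ω | 9 / 10 * (|c b₀| * pLog p (t * ek)) ≤ |Φ b₀ ω|} := by
  set S : Set Ω := {ω | 9 / 10 * (|c b₀| * pLog p (t * ek)) ≤ |Φ b₀ ω|} with hS
  have hSm : MeasurableSet S := measurableSet_le measurable_const (hΦ b₀ hb₀).abs
  set M : ℝ := C ^ (∑ b ∈ T.toLeft, m (Sum.inl b)) * t⁻¹ ^ (∑ b ∈ T.toLeft, m (Sum.inl b)) *
    ((∏ Y ∈ T.toRight, KY Y ^ m (Sum.inr Y)) * Real.exp (∑ Y ∈ T.toRight, KY Y)) with hM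
  have hM0 : 0 ≤ M :=
    mul_nonneg (mul_nonneg (pow_nonneg (by linarith) _) (pow_nonneg (inv_nonneg.mpr ht.le) _))
      (mul_nonneg (prod_nonneg fun Y hY => pow_nonneg (hKY0 Y hY) _) (Real.exp_pos _).le)
  have hpt : ∀ ω, |∏ τ ∈ T, iteratedDeriv (m τ) (slotFactor χ p ek B Φ c Ys V ω τ) t| ≤ S.indicator (fun _ => M) ω := by
    intro ω
    refine (abs_prod_iteratedDeriv_slotFactor_le χ p ek B Φ c Ys V hC1 hC hek ht ht1 h1 ω T m hm hcb KY
      (fun Y hY => hK Y hY ω)).trans ?_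
    by_cases hω : ω ∈ S
    · rw [Set.indicator_of_mem hω]
      refine mul_le_of_le_one_right hM0 (prod_le_one (fun b _ => ?_) fun b _ => ?_)
      · split_ifs
        · exact Set.indicator_nonneg (fun _ _ => zero_le_one) _
        · exact zero_le_one
      · split_ifs
        · exact Set.indicator_apply_le' (fun _ => le_rfl) fun _ => zero_le_one
        · exact le_rfl
    · rw [Set.indicator_of_notMem hω]
      have h0 : (∏ b ∈ T.toLeft, (if 1 ≤ m (Sum.inl b) then
          Set.indicator {x : ℝ | 9 / 10 * (|c b| * pLog p (t * ek)) ≤ |x|} (fun _ => (1 : ℝ)) (Φ b ω) else 1)) = 0 := by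
        refine prod_eq_zero hb₀ ?_
        rw [if_pos hmb₀, Set.indicator_of_notMem]
        exact hω
      rw [h0, mul_zero]
  calc ∫ ω, |∏ τ ∈ T, iteratedDeriv (m τ) (slotFactor χ p ek B Φ c Ys V ω τ) t| ∂P
      ≤ ∫ ω, S.indicator (fun _ => M) ω ∂P :=
        integral_mono_of_nonneg (Filter.Eventually.of_forall fun ω => abs_nonneg _) ((integrable_const M).indicator hSm)
          (Filter.Eventually.of_forall hpt)
    _ = M * P.real S := by rw [integral_indicator_const M hSm, smul_eq_mul, mul_comm]

/-- **p. 309, ONLY INTERACTION SLOTS DIFFERENTIATED**: `∫ |Π_τ (d/dt)^{m_τ} slotFactor_τ| dP ≤ (Π_Y K_Y^{m_Y}) e^{Σ_Y K_Y}` on a probability space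
(all `m_b = 0` on χ-slots). [cite: BalabanImbrieJaffe1988, (5.14.4) p.309] -/
theorem integral_abs_prod_iteratedDeriv_slotFactor_le_of_inr [IsProbabilityMeasure P]
    {t : ℝ} (hek : 0 < ek) (ht : 0 < t) (ht1 : t ≤ 1) (h1 : t * ek ≤ Real.exp (-1))
    (T : Finset (↥B ⊕ ↥Ys)) (m : ↥B ⊕ ↥Ys → ℕ) (hm0 : ∀ b ∈ T.toLeft, m (Sum.inl b) = 0)
    (hcb : ∀ b ∈ T.toLeft, c b ≠ 0) (KY : υ → ℝ) (hK : ∀ Y ∈ T.toRight, ∀ ω, |V Y ω| ≤ KY Y) :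
    ∫ ω, |∏ τ ∈ T, iteratedDeriv (m τ) (slotFactor χ p ek B Φ c Ys V ω τ) t| ∂P ≤
      (∏ Y ∈ T.toRight, KY Y ^ m (Sum.inr Y)) * Real.exp (∑ Y ∈ T.toRight, KY Y) := by
  set M : ℝ := (∏ Y ∈ T.toRight, KY Y ^ m (Sum.inr Y)) * Real.exp (∑ Y ∈ T.toRight, KY Y) with hM
  -- the all-orders constant is not needed: take `Ĉ = 1` at order `0`
  have hC : ∀ i, i ≤ 0 → ∀ (A : ℝ) ⦃q ek t : ℝ⦄, q ≠ 0 → 0 < ek → 0 < t → t * ek ≤ Real.exp (-1) →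
      |iteratedDeriv i (fun s => cutoff χ (q * pLog p (s * ek)) A) t| ≤ 1 * t ^ (-(i : ℤ)) := by
    intro i hi A q ek t _ _ _ _
    obtain rfl : i = 0 := Nat.le_zero.mp hi
    simpa using abs_cutoff_le_one χ (q * pLog p (t * ek)) A
  have hpt : ∀ ω, |∏ τ ∈ T, iteratedDeriv (m τ) (slotFactor χ p ek B Φ c Ys V ω τ) t| ≤ M := by
    intro ω
    have h := abs_prod_iteratedDeriv_slotFactor_le χ p ek B Φ c Ys V le_rfl hC hek ht ht1 h1 ω T m
      (fun b hb => (hm0 b hb).le) hcb KY (fun Y hY => hK Y hY ω)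
    have hs : ∑ b ∈ T.toLeft, m (Sum.inl b) = 0 := sum_eq_zero fun b hb => hm0 b hb
    have hJ : (∏ b ∈ T.toLeft, (if 1 ≤ m (Sum.inl b) then
        Set.indicator {x : ℝ | 9 / 10 * (|c b| * pLog p (t * ek)) ≤ |x|} (fun _ => (1 : ℝ)) (Φ b ω) else 1)) = 1 :=
      prod_eq_one fun b hb => by rw [hm0 b hb]; simp
    rw [hs, hJ, pow_zero, pow_zero, one_mul, one_mul, mul_one] at h
    exact h
  calc ∫ ω, |∏ τ ∈ T, iteratedDeriv (m τ) (slotFactor χ p ek B Φ c Ys V ω τ) t| ∂P ≤ ∫ _, M ∂P :=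
        integral_mono_of_nonneg (Filter.Eventually.of_forall fun ω => abs_nonneg _) (integrable_const M)
          (Filter.Eventually.of_forall hpt)
    _ = M := by rw [integral_const, smul_eq_mul, probReal_univ, one_mul]

/-- measurability of the undifferentiated one-cube integrand (continuous `χ(1,·)`, measurable slot fields and terms).
[cite: BalabanImbrieJaffe1988, (5.14.2) p.308] -/
theorem measurable_prod_slotFactor (t : ℝ) (T : Finset (↥B ⊕ ↥Ys)) (hΦ : ∀ b ∈ T.toLeft, Measurable (Φ b))
    (hV : ∀ Y ∈ T.toRight, Measurable (V Y)) :
    Measurable fun ω => ∏ τ ∈ T, slotFactor χ p ek B Φ c Ys V ω τ t := by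
  refine Finset.measurable_prod T fun τ hτ => ?_
  rcases τ with b | Y
  · simp only [slotFactor_inl, cutoff]
    exact χ.smooth.continuous.measurable.comp ((hΦ b (Finset.mem_toLeft.mpr hτ)).div_const _)
  · simp only [slotFactor_inr]
    exact Real.measurable_exp.comp (((hV Y (Finset.mem_toRight.mpr hτ)).const_mul t).neg)

/-- **p. 307/309, NO DERIVATIVE ON THE CUBE** (p. 307: *"If |X_α| = 1, with no F^{m̄}_{k,loc}-factors, then we have the more precise bound
|g₂(X_α) − 1| ≤ e^β(L^kε/ε₀)^{1/4−α}, obtained … from extremely small factors when a χ′-factor is replaced by 1"*; p. 309: *"The bound for H_β = ∅,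
|X_β| = 1 was obtained for g₂, and the same proof applies here"*): on a probability space, for `χ ≥ 0`, `|V(Y)| ≤ K_Y`, `0 < t ≤ 1`, `te_k ≤ e⁻¹`,
`c_b ≠ 0`: `|∫ χ′_{□,t} e^{−tṼ(□)} dP − 1| ≤ e^{Σ K_Y} Σ_b P{(9/10)|c_b|p(te_k) ≤ |Φ_b|} + (e^{Σ K_Y} − 1)` — replacing a χ-factor by `1` costs the
tail probability, replacing `e^{−tṼ}` by `1` costs `e^{Σ K} − 1`. [cite: BalabanImbrieJaffe1988, p.307 (Sect. 5.13); (5.14.4) p.309] -/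
theorem abs_integral_prod_slotFactor_sub_one_le [IsProbabilityMeasure P] (hχ : ∀ x, 0 ≤ χ.χ₁ x)
    {t : ℝ} (hek : 0 < ek) (ht : 0 < t) (ht1 : t ≤ 1) (h1 : t * ek ≤ Real.exp (-1))
    (T : Finset (↥B ⊕ ↥Ys)) (hcb : ∀ b ∈ T.toLeft, c b ≠ 0) (KY : υ → ℝ) (hK : ∀ Y ∈ T.toRight, ∀ ω, |V Y ω| ≤ KY Y)
    (hΦ : ∀ b ∈ T.toLeft, Measurable (Φ b)) (hV : ∀ Y ∈ T.toRight, Measurable (V Y)) :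
    |∫ ω, ∏ τ ∈ T, slotFactor χ p ek B Φ c Ys V ω τ t ∂P - 1| ≤
      Real.exp (∑ Y ∈ T.toRight, KY Y) * ∑ b ∈ T.toLeft, P.real {ω | 9 / 10 * (|c b| * pLog p (t * ek)) ≤ |Φ b ω|} +
        (Real.exp (∑ Y ∈ T.toRight, KY Y) - 1) := by
  have h1' : t * ek < 1 := h1.trans_lt (by rw [← Real.exp_zero]; exact Real.exp_lt_exp.mpr (by norm_num))
  have hP : 0 < pLog p (t * ek) := pLog_pos p (mul_pos ht hek) h1'
  set K : ℝ := ∑ Y ∈ T.toRight, KY Y with hKdef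
  set S : Set Ω := ⋃ b ∈ T.toLeft, {ω | 9 / 10 * (|c b| * pLog p (t * ek)) ≤ |Φ b ω|} with hS
  have hSm : MeasurableSet S :=
    Finset.measurableSet_biUnion _ fun b hb => measurableSet_le measurable_const (hΦ b hb).abs
  set f : Ω → ℝ := fun ω => ∏ τ ∈ T, slotFactor χ p ek B Φ c Ys V ω τ t with hf
  have hfm : Measurable f := measurable_prod_slotFactor χ p ek B Φ c Ys V t T hΦ hV
  have hfb : ∀ ω, |f ω| ≤ Real.exp K := fun ω => abs_prod_slotFactor_le χ p ek B Φ c Ys V ht.le ht1 ω T KY fun Y hY => hK Y hY ω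
  have hfi : Integrable f P :=
    (integrable_const (Real.exp K)).mono' hfm.aestronglyMeasurable
      (Filter.Eventually.of_forall fun ω => by rw [Real.norm_eq_abs]; exact hfb ω)
  -- pointwise: `|f − 1| ≤ 𝟙_S e^K + (e^K − 1)`
  have hpt : ∀ ω, |f ω - 1| ≤ S.indicator (fun _ => Real.exp K) ω + (Real.exp K - 1) := by
    intro ω
    have hsplit : f ω = (∏ b ∈ T.toLeft, slotFactor χ p ek B Φ c Ys V ω (Sum.inl b) t) *
        ∏ Y ∈ T.toRight, slotFactor χ p ek B Φ c Ys V ω (Sum.inr Y) t := by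
      rw [hf]; exact Finset.prod_sum_eq_prod_toLeft_mul_prod_toRight _ _
    set a : ℝ := ∏ b ∈ T.toLeft, slotFactor χ p ek B Φ c Ys V ω (Sum.inl b) t with ha
    set e : ℝ := ∏ Y ∈ T.toRight, slotFactor χ p ek B Φ c Ys V ω (Sum.inr Y) t with he
    have ha0 : 0 ≤ a := prod_nonneg fun b _ => by rw [slotFactor_inl]; exact hχ _
    have ha1 : a ≤ 1 := prod_le_one (fun b _ => by rw [slotFactor_inl]; exact hχ _) fun b _ => by
      rw [slotFactor_inl]; exact (le_abs_self _).trans (abs_cutoff_le_one χ _ _)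
    have heexp : e = Real.exp (∑ Y ∈ T.toRight, -(t * V Y ω)) := by
      rw [he, Real.exp_sum]
      exact prod_congr rfl fun Y _ => by rw [slotFactor_inr]
    have hex : |∑ Y ∈ T.toRight, -(t * V Y ω)| ≤ K := by
      refine (abs_sum_le_sum_abs _ _).trans (sum_le_sum fun Y hY => ?_)
      rw [abs_neg, abs_mul, abs_of_nonneg ht.le]
      exact (mul_le_of_le_one_left (abs_nonneg _) ht1).trans (hK Y hY ω)
    have he0 : 0 ≤ e := by rw [heexp]; exact (Real.exp_pos _).le
    have heK : e ≤ Real.exp K := by rw [heexp]; exact Real.exp_le_exp.mpr ((le_abs_self _).trans hex)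
    -- `|eˣ − 1| ≤ e^{|x|} − 1 ≤ e^K − 1` (`2 ≤ eˣ + e^{−x}`)
    have hexp1 : ∀ x : ℝ, |Real.exp x - 1| ≤ Real.exp |x| - 1 := fun x => by
      rcases le_or_gt 0 x with hx | hx
      · rw [abs_of_nonneg hx, abs_of_nonneg (by linarith [Real.one_le_exp hx] : 0 ≤ Real.exp x - 1)]
      · have h1 : Real.exp x < 1 := Real.exp_lt_one_iff.mpr hx
        rw [abs_of_neg hx, abs_of_neg (by linarith : Real.exp x - 1 < 0)]
        have h2 : x + 1 ≤ Real.exp x := Real.add_one_le_exp x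
        have h3 : -x + 1 ≤ Real.exp (-x) := Real.add_one_le_exp (-x)
        linarith
    have he1 : |e - 1| ≤ Real.exp K - 1 := by
      rw [heexp]
      exact (hexp1 _).trans (sub_le_sub_right (Real.exp_le_exp.mpr hex) 1)
    -- `1 − a ≤ 𝟙_S`: off `S` every χ-factor equals `1`
    have h1a : 1 - a ≤ S.indicator (fun _ => (1 : ℝ)) ω := by
      by_cases hω : ω ∈ S
      · rw [Set.indicator_of_mem hω]; linarith
      · rw [Set.indicator_of_notMem hω]
        have hall : a = 1 := prod_eq_one fun b hb => by
          rw [slotFactor_inl]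
          show cutoff χ (c b * pLog p (t * ek)) (Φ b ω) = 1
          have hlt : ¬ 9 / 10 * (|c b| * pLog p (t * ek)) ≤ |Φ b ω| := fun h =>
            hω (by rw [hS]; exact Set.mem_iUnion₂.mpr ⟨b, hb, h⟩)
          have hq : 0 < |c b| * pLog p (t * ek) := mul_pos (abs_pos.mpr (hcb b hb)) hP
          refine χ.eq_one _ ?_
          rw [abs_div, abs_mul, abs_of_pos hP, div_le_iff₀ hq]
          linarith
        rw [hall]; simp
    calc |f ω - 1| = |(a - 1) * e + (e - 1)| := by rw [hsplit]; ring_nf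
      _ ≤ |a - 1| * |e| + |e - 1| := (abs_add_le _ _).trans (by rw [abs_mul])
      _ = (1 - a) * e + |e - 1| := by rw [abs_of_nonpos (by linarith), abs_of_nonneg he0]; ring
      _ ≤ S.indicator (fun _ => (1 : ℝ)) ω * Real.exp K + (Real.exp K - 1) :=
          add_le_add (mul_le_mul h1a heK he0 (Set.indicator_nonneg (fun _ _ => zero_le_one) _)) he1
      _ = S.indicator (fun _ => Real.exp K) ω + (Real.exp K - 1) := by
          by_cases hω : ω ∈ S
          · rw [Set.indicator_of_mem hω, Set.indicator_of_mem hω, one_mul]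
          · rw [Set.indicator_of_notMem hω, Set.indicator_of_notMem hω, zero_mul]
  have hsub : ∫ ω, f ω ∂P - 1 = ∫ ω, (f ω - 1) ∂P := by
    rw [integral_sub hfi (integrable_const 1), integral_const, smul_eq_mul, probReal_univ, one_mul]
  have hgi : Integrable (fun ω => S.indicator (fun _ => Real.exp K) ω + (Real.exp K - 1)) P :=
    ((integrable_const _).indicator hSm).add (integrable_const _)
  calc |∫ ω, f ω ∂P - 1| = |∫ ω, (f ω - 1) ∂P| := by rw [hsub]
    _ ≤ ∫ ω, |f ω - 1| ∂P := abs_integral_le_integral_abs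
    _ ≤ ∫ ω, (S.indicator (fun _ => Real.exp K) ω + (Real.exp K - 1)) ∂P :=
        integral_mono_of_nonneg (Filter.Eventually.of_forall fun ω => abs_nonneg _) hgi (Filter.Eventually.of_forall hpt)
    _ = Real.exp K * P.real S + (Real.exp K - 1) := by
        rw [integral_add ((integrable_const _).indicator hSm) (integrable_const _), integral_indicator_const _ hSm,
          integral_const, smul_eq_mul, smul_eq_mul, probReal_univ, one_mul, mul_comm]
    _ ≤ Real.exp K * ∑ b ∈ T.toLeft, P.real {ω | 9 / 10 * (|c b| * pLog p (t * ek)) ≤ |Φ b ω|} + (Real.exp K - 1) :=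
        add_le_add (mul_le_mul_of_nonneg_left (measureReal_biUnion_finset_le _ _) (Real.exp_pos _).le) le_rfl

end Integral

end Literature.MathematicalPhysics.QuantumFieldTheory.BalabanImbrieJaffe1984to88.BIJ88OneCubeSlotEstimates309

end
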